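import Summits.Ventures.DiscreteObjects.PP12.FixedIncidenceCounts

/-!
# PP(12): a collineation of order 5 fixes exactly a Fano subplane (kernel; JvT's `p = 5` starting point)
Framing: lottery ticket; floor = certified bounds/negative ranges.

For a projective plane of order 12 and a collineation `σ ≠ 1` with `σ⁵ = 1` on points we prove
(`fano_of_pow_five`): there are exactly 7 fixed points and 7 fixed lines, every fixed line carries exactly 3 fixed
points and every fixed point lies on exactly 3 fixed lines (the fixed structure is a subplane of order 2). This is
the fixed structure from which Janko–van Trung's computer elimination of `p = 5` (Geom. Dedicata 12 (1982)) starts;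
the elimination itself is NOT reproduced (cell pub-namedobj, target M, FAMILY-B1P §6).

Proof (all in the kernel): fixed lines carry 3 or 8 fixed points and fixed points lie on 3 or 8 fixed lines
(`FixedPointCongruences` + `not_isAxis_order12`); the double counts of `FixedIncidenceCounts` give
`8a+3b = 8c+3d`, `56a+6b = f(f−1)`, `56c+6d = L(L−1)` for the numbers `a,b` (`c,d`) of fixed lines (points) of the
two kinds, `f = c+d`, `L = a+b`, `f ≡ 2 (mod 5)`; a fixed line with 8 fixed points forces `f ≤ 20` (the fixed
points off it lie on distinct lines through a non-fixed point of it); the only solution is `a = c = 0`,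
`b = d = f = L = 7` (`fano_arith`).
-/

namespace Summit.Ventures.DiscreteObjects.PP12

open Configuration Finset
open scoped Classical

namespace Collineation

variable {P L : Type*} [Membership P L] [ProjectivePlane P L] [Fintype P] [Fintype L]
  [DecidableEq P] [DecidableEq L] (σ : Collineation P L)

/-- The arithmetic of the Fano case: the counting identities force `f = L = 7`, `a = c = 0`. -/
theorem fano_arith (a b c d f L : ℕ) (hflag : 8 * c + 3 * d = 8 * a + 3 * b)
    (hbeta : 64 * a + 9 * b = 8 * c + 3 * d + f * (f - 1))
    (hgamma : 64 * c + 9 * d = 8 * a + 3 * b + L * (L - 1))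
    (hf : f = c + d) (hL : L = a + b) (hmod : f % 5 = 2) (heps : a ≥ 1 → f ≤ 20) :
    f = 7 ∧ L = 7 ∧ a = 0 ∧ c = 0 := by
  -- f ≤ 20 in all cases
  have hf20 : f ≤ 20 := by
    by_cases ha : a ≥ 1
    · exact heps ha
    · have ha0 : a = 0 := by omega
      rcases Nat.eq_zero_or_pos f with h0 | hpos
      · omega
      · obtain ⟨k, hk⟩ : ∃ k, f = k + 1 := ⟨f - 1, by omega⟩
        have hsub : f - 1 = k := by omega
        rw [hsub] at hbeta
        rw [hk] at hbeta hf
        have e1 : 3 * b = 8 * c + 3 * d := by omega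
        have hb' : 9 * b = 8 * c + 3 * d + (k * k + k) := by
          have h := hbeta
          rw [ha0, Nat.add_mul, Nat.one_mul] at h
          linarith
        have e3 : k * k = 10 * c + 5 * k + 6 := by linarith [hb', e1, hf]
        have hc : c ≤ k + 1 := by omega
        have hkk : k * k ≤ 15 * k + 16 := by linarith
        by_contra hbig
        have h17 : 17 ≤ k := by omega
        have h17k : 17 * k ≤ k * k := Nat.mul_le_mul_right k h17
        linarith
  have hcases : f = 2 ∨ f = 7 ∨ f = 12 ∨ f = 17 := by omega
  rcases hcases with rfl | rfl | rfl | rfl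
  · exfalso; omega
  · have ha0 : a = 0 := by omega
    have hL7 : L = 7 := by omega
    subst hL7
    exact ⟨rfl, rfl, ha0, by omega⟩
  · exfalso
    have hL22 : L = 22 := by omega
    subst hL22
    omega
  · exfalso
    have h56 : 28 * a + 3 * b = 136 := by omega
    have ha4 : a ≤ 4 := by omega
    interval_cases a
    · omega
    · have hL37 : L = 37 := by omega
      subst hL37; omega
    · omega
    · omega
    · have hL12 : L = 12 := by omega
      subst hL12; omega

section OrderTwelveFive

variable (h12 : ProjectivePlane.order P L = 12) (hne : σ.onPoints ≠ 1) (hq : σ.onPoints ^ 5 = 1)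
include h12 hne hq

omit [DecidableEq L] in
/-- `σ⁵ = 1`: a fixed line carries 3 or 8 fixed points. -/
theorem fixedOnLine_q5 {l : L} [DecidablePred (· ∈ l)] (hl : σ.onLines l = l) :
    σ.fixedOnLine l = 3 ∨ σ.fixedOnLine l = 8 := by
  haveI : Fact (Nat.Prime 5) := ⟨by norm_num⟩
  rcases σ.fixedOnLine_order12_q5 h12 hl hq with h | h | h
  · exact Or.inl h
  · exact Or.inr h
  · exfalso
    exact σ.not_isAxis_order12 h12 hne hq (Or.inl rfl) l (σ.isAxis_of_fixedOnLine_eq (by rw [h, h12]))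

omit [DecidableEq P] in
/-- `σ⁵ = 1`: a fixed point lies on 3 or 8 fixed lines. -/
theorem fixedThrough_q5 {p : P} [DecidablePred fun m : L => p ∈ m] (hp : σ.onPoints p = p) :
    σ.fixedThrough p = 3 ∨ σ.fixedThrough p = 8 := by
  rw [fixedThrough_eq_dual]
  have h12' : ProjectivePlane.order (Dual L) (Dual P) = 12 := by rw [ProjectivePlane.Dual.order]; exact h12
  have hneL : σ.dual.onPoints ≠ 1 := fun h => hne (σ.onPoints_eq_one_of_onLines h)
  have hqL : σ.dual.onPoints ^ 5 = 1 := σ.onLines_pow_eq_one hq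
  exact σ.dual.fixedOnLine_q5 h12' hneL hqL hp

omit [DecidableEq L] hne hq in
/-- `σ⁵ = 1`: a fixed line with 8 fixed points forces at most 20 fixed points in all. -/
theorem fixedCard_le_of_eight {l : L} [DecidablePred (· ∈ l)] (hl : σ.onLines l = l)
    (h8 : σ.fixedOnLine l = 8) : fixedCard σ.onPoints ≤ 20 := by
  classical
  set S : Finset P := univ.filter fun x => σ.onPoints x = x with hS
  have hSdef : fixedCard σ.onPoints = S.card := rfl
  -- points of l: 13; fixed among them: 8; so a non-fixed X ∈ l exists
  have hlpts : (univ.filter fun x : P => x ∈ l).card = 13 := by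
    rw [← Fintype.card_subtype, ← Nat.card_eq_fintype_card]
    change Configuration.pointCount P l = 13
    rw [ProjectivePlane.pointCount_eq P l, h12]
  obtain ⟨X, hXl, hXnot⟩ : ∃ X : P, X ∈ l ∧ σ.onPoints X ≠ X := by
    by_contra h
    push Not at h
    have hsub : (univ.filter fun x : P => x ∈ l) ⊆ univ.filter fun x => x ∈ l ∧ σ.onPoints x = x :=
      fun x hx => by simp only [mem_filter, mem_univ, true_and] at hx ⊢; exact ⟨hx, h x hx⟩
    have := Finset.card_le_card hsub
    unfold fixedOnLine at h8
    rw [h8, hlpts] at this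
    omega
  have hSon : (S.filter fun x => x ∈ l).card = 8 := by
    unfold fixedOnLine at h8
    rw [← h8]; congr 1; ext x; simp [hS, and_comm]
  -- lines through X other than l: 12
  set LX : Finset L := (univ.filter fun m : L => X ∈ m).erase l with hLX
  have hLX12 : LX.card = 12 := by
    have h13 : (univ.filter fun m : L => X ∈ m).card = 13 := by
      rw [← Fintype.card_subtype, ← Nat.card_eq_fintype_card]
      change Configuration.lineCount L X = 13
      rw [ProjectivePlane.lineCount_eq L X, h12]
    rw [hLX, Finset.card_erase_of_mem (by simp [hXl]), h13]
  let g : P → L := fun Q => if h : X = Q then l else HasLines.mkLine h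
  have hg : ∀ Q ∈ S.filter (fun x => x ∉ l), X ∈ g Q ∧ Q ∈ g Q ∧ g Q ≠ l := by
    intro Q hQ
    have hQfix : σ.onPoints Q = Q := by have := (Finset.mem_filter.mp hQ).1; simpa [hS] using this
    have hQl : Q ∉ l := (Finset.mem_filter.mp hQ).2
    have hXQ : X ≠ Q := fun h => hXnot (h ▸ hQfix)
    simp only [g, dif_neg hXQ]
    have hax := HasLines.mkLine_ax (L := L) hXQ
    exact ⟨hax.1, hax.2, fun h => hQl (h ▸ hax.2)⟩
  have hmaps : ∀ Q ∈ S.filter (fun x => x ∉ l), g Q ∈ LX := fun Q hQ => by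
    obtain ⟨h1, -, h3⟩ := hg Q hQ
    simp [hLX, h1, h3]
  have hinj : Set.InjOn g (S.filter fun x => x ∉ l) := by
    intro Q hQ Q' hQ' heq
    by_contra hQQ'
    have hQfix : σ.onPoints Q = Q := by have := (Finset.mem_filter.mp hQ).1; simpa [hS] using this
    have hQ'fix : σ.onPoints Q' = Q' := by have := (Finset.mem_filter.mp hQ').1; simpa [hS] using this
    obtain ⟨hXm, hQm, hml⟩ := hg Q hQ
    obtain ⟨-, hQ'm, -⟩ := hg Q' hQ'
    rw [← heq] at hQ'm
    have fm := σ.line_fixed_of_two_fixed hQm hQ'm hQQ' hQfix hQ'fix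
    exact hXnot (σ.point_fixed_of_two_fixed hXm hXl hml fm hl)
  have hle := Finset.card_le_card_of_injOn g hmaps hinj
  have hsplit := Finset.card_filter_add_card_filter_not (s := S) (fun x : P => x ∈ l)
  rw [hSdef]; omega

/-- **`σ⁵ = 1` on a plane of order 12: the fixed structure is a Fano subplane** — 7 fixed points, 7 fixed lines,
3 fixed points on every fixed line, 3 fixed lines through every fixed point. -/
theorem fano_of_pow_five :
    fixedCard σ.onPoints = 7 ∧ fixedCard σ.onLines = 7 ∧
    (∀ l : L, σ.onLines l = l → σ.fixedOnLine l = 3) ∧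
    (∀ p : P, σ.onPoints p = p → σ.fixedThrough p = 3) := by
  classical
  haveI : Fact (Nat.Prime 5) := ⟨by norm_num⟩
  set S : Finset P := univ.filter fun x => σ.onPoints x = x with hS
  set T : Finset L := univ.filter fun m => σ.onLines m = m with hT
  have hSdef : fixedCard σ.onPoints = S.card := rfl
  have hTdef : fixedCard σ.onLines = T.card := rfl
  -- f ≡ 2 (mod 5)
  have hmod : S.card % 5 = 2 := by
    have h := σ.card_fixedPoints_modEq_card hq
    rw [h12] at h; unfold Nat.ModEq at h; norm_num at h; rw [← hSdef]; omega
  -- value constraints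
  have hk : ∀ m ∈ T, σ.fixedOnLine m = 3 ∨ σ.fixedOnLine m = 8 := fun m hm =>
    σ.fixedOnLine_q5 h12 hne hq (by simpa [hT] using hm)
  have ht : ∀ p ∈ S, σ.fixedThrough p = 3 ∨ σ.fixedThrough p = 8 := fun p hp =>
    σ.fixedThrough_q5 h12 hne hq (by simpa [hS] using hp)
  -- (α) flags, (γ) line pairs, (β) point pairs
  have hflag : ∑ p ∈ S, σ.fixedThrough p = ∑ m ∈ T, σ.fixedOnLine m := σ.fixed_flag_count
  have hgamma : ∑ p ∈ S, σ.fixedThrough p ^ 2 = ∑ m ∈ T, σ.fixedOnLine m + T.card * (T.card - 1) :=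
    σ.fixed_line_pair_count
  have hbeta : ∑ m ∈ T, σ.fixedOnLine m ^ 2 = ∑ p ∈ S, σ.fixedThrough p + S.card * (S.card - 1) :=
    σ.fixed_point_pair_count
  -- numeric form
  obtain ⟨hks, hks2, hab⟩ := sum_three_eight T (fun m => σ.fixedOnLine m) hk
  obtain ⟨hts, hts2, hcd⟩ := sum_three_eight S (fun p => σ.fixedThrough p) ht
  set a := (T.filter fun m => σ.fixedOnLine m = 8).card
  set b := (T.filter fun m => ¬ σ.fixedOnLine m = 8).card
  set c := (S.filter fun p => σ.fixedThrough p = 8).card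
  set d := (S.filter fun p => ¬ σ.fixedThrough p = 8).card
  rw [hts] at hflag hbeta; rw [hks] at hflag hgamma; rw [hts2] at hgamma; rw [hks2] at hbeta
  -- (ε) an 8-line bounds f by 20
  have heps : a ≥ 1 → S.card ≤ 20 := by
    intro ha
    obtain ⟨m, hm⟩ := Finset.card_pos.mp ha
    have hm' := Finset.mem_filter.mp hm
    have := σ.fixedCard_le_of_eight h12 (by simpa [hT] using hm'.1) hm'.2
    rwa [hSdef] at this
  have hfS : S.card = c + d := hcd.symm
  have hLT : T.card = a + b := hab.symm
  -- helper: a = 0 ⇒ every fixed line carries 3; c = 0 ⇒ every fixed point lies on 3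
  have hall3 : a = 0 → c = 0 → (∀ l : L, σ.onLines l = l → σ.fixedOnLine l = 3) ∧
      (∀ p : P, σ.onPoints p = p → σ.fixedThrough p = 3) := by
    intro ha0 hc0
    have hT8 : ∀ m ∈ T, ¬ σ.fixedOnLine m = 8 := fun m hm h8 =>
      Finset.card_pos.mpr ⟨m, Finset.mem_filter.mpr ⟨hm, h8⟩⟩ |>.ne' ha0
    have hS8 : ∀ p ∈ S, ¬ σ.fixedThrough p = 8 := fun p hp h8 =>
      Finset.card_pos.mpr ⟨p, Finset.mem_filter.mpr ⟨hp, h8⟩⟩ |>.ne' hc0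
    refine ⟨fun l hl => ?_, fun p hp => ?_⟩
    · have hlT : l ∈ T := by simpa [hT] using hl
      exact (hk l hlT).resolve_right (hT8 l hlT)
    · have hpS : p ∈ S := by simpa [hS] using hp
      exact (ht p hpS).resolve_right (hS8 p hpS)
  obtain ⟨hf7, hL7, ha0, hc0⟩ := fano_arith a b c d S.card T.card hflag hbeta hgamma hfS hLT hmod heps
  obtain ⟨h3l, h3p⟩ := hall3 ha0 hc0
  exact ⟨by rw [hSdef, hf7], by rw [hTdef, hL7], h3l, h3p⟩

end OrderTwelveFive

end Collineation

end Summit.Ventures.DiscreteObjects.PP12
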